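import Mathlib

/-!
# SoloBlind — the Chebyshev parameter shift and its truncation term (kernel #183)

E1-lite, Chebyshev basis (PLAN §105, A331).  On a kernel box the unknown is carried as a truncated
Chebyshev sum `W̃(x) = Σ_{m ≤ d} a_m T_m(x)` and the generator is affine in the parameter,
`D_P = D_{P_c} + s·x·D₁`.  Multiplication by `x` acts on Chebyshev coefficients through the
three-term law `x T_0 = T_1`, `x T_{m+1} = (T_{m+2} + T_m)/2`; on a sum truncated at degree
`d = n + 2` this gives EXACTLY the block-tridiagonal coefficients used by the box engine
(`[xW]_0 = a_1/2`, `[xW]_1 = a_0 + a_2/2`, `[xW]_m = (a_{m-1} + a_{m+1})/2` for `2 ≤ m ≤ d`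
with `a_{d+1} := 0`) PLUS the single dropped term `(a_d/2) T_{d+1}` — the truncation that the
certificate carries as a transported defect `(s/2) D₁ ã_d T_{d+1}`.  We prove the identity for any
sequence `τ` obeying the three-term law over a field (`threeTerm_shift_sum`) and instantiate it
for the real Chebyshev polynomials cast into `ℝ` or `ℂ` (`chebyshevShift_sum`).
-/

namespace Summit.AnomalousDissipation.AnomalousDissipation.Theorems

open Polynomial Polynomial.Chebyshev Finset

/-- THE SHIFT IDENTITY for an abstract three-term sequence: with `x τ₀ = τ₁` and
`x τ_{m+1} = (τ_{m+2} + τ_m)/2`,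
`x · Σ_{m ≤ n+2} a_m τ_m = (a₁/2)τ₀ + (a₀ + a₂/2)τ₁ + Σ_{m<n} ((a_{m+1}+a_{m+3})/2) τ_{m+2}`
`+ (a_{n+1}/2) τ_{n+2} + (a_{n+2}/2) τ_{n+3}` — the last summand is the truncation term. -/
theorem threeTerm_shift_sum {𝕜 : Type*} [Field 𝕜] (x : 𝕜) (a τ : ℕ → 𝕜)
    (h0 : x * τ 0 = τ 1) (h : ∀ m : ℕ, x * τ (m + 1) = (τ (m + 2) + τ m) / 2) (n : ℕ) :
    x * ∑ m ∈ range (n + 3), a m * τ m =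
      a 1 / 2 * τ 0 + (a 0 + a 2 / 2) * τ 1
        + ∑ m ∈ range n, (a (m + 1) + a (m + 3)) / 2 * τ (m + 2)
        + a (n + 1) / 2 * τ (n + 2) + a (n + 2) / 2 * τ (n + 3) := by
  induction n with
  | zero =>
      have h1 : x * τ 1 = (τ 2 + τ 0) / 2 := h 0
      have h2 : x * τ 2 = (τ 3 + τ 1) / 2 := h 1
      simp only [sum_range_succ, sum_range_zero, zero_add]
      linear_combination a 0 * h0 + a 1 * h1 + a 2 * h2
  | succ n ih =>
      have hn : x * τ (n + 3) = (τ (n + 4) + τ (n + 2)) / 2 := h (n + 2)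
      rw [sum_range_succ, mul_add, ih, sum_range_succ]
      have e1 : n + 1 + 1 = n + 2 := rfl
      have e2 : n + 1 + 2 = n + 3 := rfl
      have e3 : n + 1 + 3 = n + 4 := rfl
      simp only [e1, e2, e3]
      linear_combination a (n + 3) * hn

/-- The real Chebyshev polynomials (cast into `𝕜 = ℝ` or `ℂ`) obey the three-term law. -/
theorem chebyshev_threeTerm {𝕜 : Type*} [RCLike 𝕜] (x : ℝ) (m : ℕ) :
    (x : 𝕜) * (((T ℝ (m + 1)).eval x : ℝ) : 𝕜) =
      ((((T ℝ (m + 2)).eval x : ℝ) : 𝕜) + (((T ℝ m).eval x : ℝ) : 𝕜)) / 2 := by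
  have key : (T ℝ ((m : ℤ) + 2)).eval x = 2 * x * (T ℝ ((m : ℤ) + 1)).eval x - (T ℝ (m : ℤ)).eval x := by
    rw [T_add_two]; simp
  rw [key]
  push_cast
  ring

/-- `x T_0 = T_1`. -/
theorem chebyshev_threeTerm_zero {𝕜 : Type*} [RCLike 𝕜] (x : ℝ) :
    (x : 𝕜) * (((T ℝ (0 : ℕ)).eval x : ℝ) : 𝕜) = (((T ℝ (1 : ℕ)).eval x : ℝ) : 𝕜) := by
  simp

/-- THE CHEBYSHEV SHIFT IDENTITY of an E1-lite box (degree `d = n + 2`):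
`x · Σ_{m ≤ d} a_m T_m(x) = Σ (retained block-tridiagonal coefficients) · T_m(x) + (a_d/2) T_{d+1}(x)`. -/
theorem chebyshevShift_sum {𝕜 : Type*} [RCLike 𝕜] (x : ℝ) (a : ℕ → 𝕜) (n : ℕ) :
    (x : 𝕜) * ∑ m ∈ range (n + 3), a m * (((T ℝ m).eval x : ℝ) : 𝕜) =
      a 1 / 2 * (((T ℝ (0 : ℕ)).eval x : ℝ) : 𝕜) + (a 0 + a 2 / 2) * (((T ℝ (1 : ℕ)).eval x : ℝ) : 𝕜)
        + ∑ m ∈ range n, (a (m + 1) + a (m + 3)) / 2 * (((T ℝ ((m + 2 : ℕ) : ℤ)).eval x : ℝ) : 𝕜)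
        + a (n + 1) / 2 * (((T ℝ ((n + 2 : ℕ) : ℤ)).eval x : ℝ) : 𝕜)
        + a (n + 2) / 2 * (((T ℝ ((n + 3 : ℕ) : ℤ)).eval x : ℝ) : 𝕜) :=
  threeTerm_shift_sum (x : 𝕜) a (fun m => (((T ℝ m).eval x : ℝ) : 𝕜))
    (chebyshev_threeTerm_zero x) (chebyshev_threeTerm x) n

end Summit.AnomalousDissipation.AnomalousDissipation.Theorems
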